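import Literature.Probability.Percolation.FKLoopWindingCells

/-!
# Stub `s17_heightsExist` of line `rainbow-monomials-in-excursion-kernels` — Part 1:
# weighted dart winding numbers on the medial lattice
# (crux `BoundaryDefectGaussianR`, stmt-CriticalPhenomena-14132; insertion dictionary D2, T5c)

The existence theorem T5c (`s17_heightsExist`: every arrow assignment `s` that is invariant under
the turning rule of a rainbow configuration and takes the forced values at the cuts is the arrow
assignment of a valid height configuration) builds the new heights as `h = h₀ + H`, where `h₀` is
the given valid configuration and `H` is the **weighted dart winding number**

  `H(F) = ∑_{c ∈ CS} w(c) · dartWnd(cornerDart c, F)`,   `w(c) = sgn (s c) - sgn (bit h₀ c)`,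

summed over the corners `CS` over the piece (`MedialTrail.dartWnd`: the contribution of one dart of
the oriented medial graph to the horizontal-ray winding number of the cell `F`; `cornerDart c`: the
dart of the corner `c`, with the vertex square `vcell c.1` on its left and the face square
`fcell (cFace c)` on its right). This Part is the model-free toolkit for such sums, for an ARBITRARY
finite set of corners `CS` and weight `w`:

* `hw_sub_west` — the jump across a vertical segment (hypothesis-free, dart by dart);
* `hw_sub_south` — the jump across a horizontal segment, under the **cycle condition**
  `∀ g, ∑_{c ∈ CS} w(c) · (g(head c) - g(tail c)) = 0` (the weighted darts form a divergence-free
  chain: Kirchhoff's identity `dart_flux` summed with weights);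
* `hw_jump_dart`, **`hw_jump_corner`** (registered as `s17_heightsExist_part1`) — across the dart
  of a corner `c₁`, `H` drops from the vertex square to the face square by exactly `w(c₁)`
  (`0` off `CS`): the reversed dart is not a dart of the oriented medial graph, and distinct corners
  carry distinct darts;
* `hw_lf_eq_rf_of_not_mem`, `hw_eq_west`, `hw_eq_south` — no jump across a side one of whose two
  squares is not a cell, when non-zero weights sit on corners with both squares cells;
* `hw_exists_bound`, `hw_eq_zero_of_far` — `H` vanishes outside a bounded box (west, north and
  south by the ray count, east by the cycle condition).

All [folklore] bookkeeping over `MedialTrailUmlaufsatz` / `FKLoopWindingCells`.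
-/

namespace Summit.CriticalPhenomena.CardyFormulaZ2.Cruxes.BoundaryDefectGaussianR.RainbowMonomialsInExcursionKernels

open Finset Literature.Probability.LatticeModels Literature.Probability.Percolation
open Literature.Probability.LatticeModels.MedialTrail

section Weighted

variable (CS : Finset (Site 2 × Fin 4)) (w : Site 2 × Fin 4 → ℤ)

/-- **Jump across a vertical segment** of a weighted dart sum: between the squares `(x, y)` and
`(x - 1, y)` it is the weighted signed number of darts on the segment. [folklore] -/
theorem hw_sub_west (x y : ℤ) :
    (∑ c ∈ CS, w c * dartWnd (cornerDart c) (x, y)) - (∑ c ∈ CS, w c * dartWnd (cornerDart c) (x - 1, y)) =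
      ∑ c ∈ CS, w c * ((if cornerDart c = ((x, y + 1), (x, y)) then 1 else 0) -
        (if cornerDart c = ((x, y), (x, y + 1)) then 1 else 0)) := by
  rw [← Finset.sum_sub_distrib]
  refine Finset.sum_congr rfl fun c _ => ?_
  rw [← mul_sub, dartWnd_sub_west]

/-- **Jump across a horizontal segment** of a weighted dart sum satisfying the cycle condition:
between the squares `(x, y)` and `(x, y - 1)` it is the weighted signed number of darts on the
segment (Kirchhoff: the weighted flux out of a half-row vanishes). [folklore] -/
theorem hw_sub_south
    (hdiv : ∀ g : ℤ × ℤ → ℤ, ∑ c ∈ CS, w c * (g (cornerDart c).2 - g (cornerDart c).1) = 0) (x y : ℤ) :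
    (∑ c ∈ CS, w c * dartWnd (cornerDart c) (x, y)) - (∑ c ∈ CS, w c * dartWnd (cornerDart c) (x, y - 1)) =
      ∑ c ∈ CS, w c * ((if cornerDart c = ((x, y), (x + 1, y)) then 1 else 0) -
        (if cornerDart c = ((x + 1, y), (x, y)) then 1 else 0)) := by
  rw [← Finset.sum_sub_distrib]
  calc ∑ c ∈ CS, (w c * dartWnd (cornerDart c) (x, y) - w c * dartWnd (cornerDart c) (x, y - 1))
      = ∑ c ∈ CS, (w c * (rowInd x y (cornerDart c).2 - rowInd x y (cornerDart c).1) +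
          w c * ((if cornerDart c = ((x, y), (x + 1, y)) then 1 else 0) -
            (if cornerDart c = ((x + 1, y), (x, y)) then 1 else 0))) := by
        refine Finset.sum_congr rfl fun c _ => ?_
        have hflux := dart_flux (cornerDart c) (isDart_cornerDart c) x y
        rw [hflux]; ring
    _ = _ := by rw [Finset.sum_add_distrib, hdiv, zero_add]

/-- No corner carries the reverse of the dart of a corner (the reverse of a dart of the oriented
medial graph is not a dart). [folklore] -/
theorem hw_cornerDart_ne_swap (c c₁ : Site 2 × Fin 4) : cornerDart c ≠ (cornerDart c₁).swap := by
  intro h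
  have h1 := isDart_cornerDart c
  rw [h] at h1
  exact (isDart_cornerDart c₁).not_swap h1

/-- **Jump across a dart of the oriented medial graph**: from its left square to its right square a
weighted dart sum satisfying the cycle condition drops by the total weight of the corners carrying
that dart, minus the (vanishing) weight of the corners carrying its reverse. [folklore] -/
theorem hw_jump_dart
    (hdiv : ∀ g : ℤ × ℤ → ℤ, ∑ c ∈ CS, w c * (g (cornerDart c).2 - g (cornerDart c).1) = 0)
    (d : MedialTrail.Pt × MedialTrail.Pt) (hd : IsDart d.1 d.2) :
    (∑ c ∈ CS, w c * dartWnd (cornerDart c) (lf d)) - (∑ c ∈ CS, w c * dartWnd (cornerDart c) (rf d)) =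
      ∑ c ∈ CS, w c * ((if cornerDart c = d then 1 else 0) - (if cornerDart c = d.swap then 1 else 0)) := by
  obtain ⟨a, b, rfl | rfl | rfl | rfl⟩ := hd.cases
  · -- north
    rw [lf_north, rf_north, Prod.swap_prod_mk,
      show (∑ c ∈ CS, w c * dartWnd (cornerDart c) (a - 1, b)) - (∑ c ∈ CS, w c * dartWnd (cornerDart c) (a, b)) =
        -((∑ c ∈ CS, w c * dartWnd (cornerDart c) (a, b)) - (∑ c ∈ CS, w c * dartWnd (cornerDart c) (a - 1, b))) by ring,
      hw_sub_west, ← Finset.sum_neg_distrib]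
    exact Finset.sum_congr rfl fun c _ => by ring
  · -- south
    have h1 := hw_sub_west CS w a (b - 1)
    simp only [sub_add_cancel] at h1
    rw [lf_south, rf_south, Prod.swap_prod_mk, h1]
  · -- east
    rw [lf_east, rf_east, Prod.swap_prod_mk, hw_sub_south CS w hdiv]
  · -- west
    have h1 := hw_sub_south CS w hdiv (a - 1) b
    simp only [sub_add_cancel] at h1
    rw [lf_west, rf_west, Prod.swap_prod_mk,
      show (∑ c ∈ CS, w c * dartWnd (cornerDart c) (a - 1, b - 1)) - (∑ c ∈ CS, w c * dartWnd (cornerDart c) (a - 1, b)) =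
        -((∑ c ∈ CS, w c * dartWnd (cornerDart c) (a - 1, b)) - (∑ c ∈ CS, w c * dartWnd (cornerDart c) (a - 1, b - 1))) by ring,
      h1, ← Finset.sum_neg_distrib]
    exact Finset.sum_congr rfl fun c _ => by ring

/-- **Jump across the dart of a corner**: from the vertex square `vcell c₁.1` to the face square
`fcell (cFace c₁)` a weighted dart sum satisfying the cycle condition drops by the weight of `c₁`
(by `0` if `c₁ ∉ CS`). [folklore] -/
theorem hw_jump_corner
    (hdiv : ∀ g : ℤ × ℤ → ℤ, ∑ c ∈ CS, w c * (g (cornerDart c).2 - g (cornerDart c).1) = 0)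
    (c₁ : Site 2 × Fin 4) :
    (∑ c ∈ CS, w c * dartWnd (cornerDart c) (vcell c₁.1)) -
        (∑ c ∈ CS, w c * dartWnd (cornerDart c) (fcell (cFace c₁))) = if c₁ ∈ CS then w c₁ else 0 := by
  rw [← lf_cornerDart, ← rf_cornerDart, hw_jump_dart CS w hdiv _ (isDart_cornerDart c₁)]
  rw [Finset.sum_congr rfl (fun c _ => by rw [if_neg (hw_cornerDart_ne_swap c c₁), sub_zero])]
  simp_rw [cornerDart_injective.eq_iff, mul_boole]
  exact Finset.sum_ite_eq' CS c₁ w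

/-- **No jump across a side with a non-cell**: if every corner of non-zero weight has both of its
squares in `U`, then across a dart one of whose two squares is not in `U` the weighted dart sum does
not jump. [folklore] -/
theorem hw_lf_eq_rf_of_not_mem
    (hdiv : ∀ g : ℤ × ℤ → ℤ, ∑ c ∈ CS, w c * (g (cornerDart c).2 - g (cornerDart c).1) = 0)
    (U : Finset MedialTrail.Pt) (hU : ∀ c ∈ CS, w c ≠ 0 → lf (cornerDart c) ∈ U ∧ rf (cornerDart c) ∈ U)
    (d : MedialTrail.Pt × MedialTrail.Pt) (hd : IsDart d.1 d.2) (h : lf d ∉ U ∨ rf d ∉ U) :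
    (∑ c ∈ CS, w c * dartWnd (cornerDart c) (lf d)) = ∑ c ∈ CS, w c * dartWnd (cornerDart c) (rf d) := by
  have hj := hw_jump_dart CS w hdiv d hd
  have h0 : ∑ c ∈ CS, w c * ((if cornerDart c = d then 1 else 0) - (if cornerDart c = d.swap then 1 else 0)) = 0 := by
    refine Finset.sum_eq_zero fun c hc => ?_
    by_cases hw : w c = 0
    · rw [hw, zero_mul]
    have hsw : cornerDart c ≠ d.swap := fun h' => hd.not_swap (by have := isDart_cornerDart c; rw [h'] at this; exact this)
    rw [if_neg hsw, sub_zero]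
    by_cases hcd : cornerDart c = d
    · obtain ⟨h1, h2⟩ := hU c hc hw
      rw [hcd] at h1 h2
      exact absurd h2 (h.resolve_left (not_not.2 h1))
    · rw [if_neg hcd, mul_zero]
  rw [h0, sub_eq_zero] at hj
  exact hj

/-- A square and its western neighbour carry the same weighted dart sum if one of them is not in
`U` (non-zero weights on corners with both squares in `U`). [folklore] -/
theorem hw_eq_west
    (hdiv : ∀ g : ℤ × ℤ → ℤ, ∑ c ∈ CS, w c * (g (cornerDart c).2 - g (cornerDart c).1) = 0)
    (U : Finset MedialTrail.Pt) (hU : ∀ c ∈ CS, w c ≠ 0 → lf (cornerDart c) ∈ U ∧ rf (cornerDart c) ∈ U)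
    (F : MedialTrail.Pt) (h : F ∉ U ∨ (F.1 - 1, F.2) ∉ U) :
    (∑ c ∈ CS, w c * dartWnd (cornerDart c) F) = ∑ c ∈ CS, w c * dartWnd (cornerDart c) (F.1 - 1, F.2) := by
  rcases faces_westSeg F with ⟨h1, h2⟩ | ⟨h1, h2⟩
  · have := hw_lf_eq_rf_of_not_mem CS w hdiv U hU (westSeg F) (isDart_westSeg F) (by rw [h1, h2]; exact h.symm)
    rw [h1, h2] at this
    exact this.symm
  · have := hw_lf_eq_rf_of_not_mem CS w hdiv U hU (westSeg F) (isDart_westSeg F) (by rw [h1, h2]; exact h)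
    rwa [h1, h2] at this

/-- A square and its southern neighbour carry the same weighted dart sum if one of them is not in
`U` (non-zero weights on corners with both squares in `U`). [folklore] -/
theorem hw_eq_south
    (hdiv : ∀ g : ℤ × ℤ → ℤ, ∑ c ∈ CS, w c * (g (cornerDart c).2 - g (cornerDart c).1) = 0)
    (U : Finset MedialTrail.Pt) (hU : ∀ c ∈ CS, w c ≠ 0 → lf (cornerDart c) ∈ U ∧ rf (cornerDart c) ∈ U)
    (F : MedialTrail.Pt) (h : F ∉ U ∨ (F.1, F.2 - 1) ∉ U) :
    (∑ c ∈ CS, w c * dartWnd (cornerDart c) F) = ∑ c ∈ CS, w c * dartWnd (cornerDart c) (F.1, F.2 - 1) := by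
  rcases faces_southSeg F with ⟨h1, h2⟩ | ⟨h1, h2⟩
  · have := hw_lf_eq_rf_of_not_mem CS w hdiv U hU (southSeg F) (isDart_southSeg F) (by rw [h1, h2]; exact h.symm)
    rw [h1, h2] at this
    exact this.symm
  · have := hw_lf_eq_rf_of_not_mem CS w hdiv U hU (southSeg F) (isDart_southSeg F) (by rw [h1, h2]; exact h)
    rwa [h1, h2] at this

/-! ### Vanishing outside a box -/

/-- All darts of the corners of `CS` lie in a box `[-B, B]²`. [folklore] -/
theorem hw_exists_bound : ∃ B : ℤ, 0 ≤ B ∧ ∀ c ∈ CS, |(cornerDart c).1.1| ≤ B ∧ |(cornerDart c).1.2| ≤ B ∧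
    |(cornerDart c).2.1| ≤ B ∧ |(cornerDart c).2.2| ≤ B := by
  obtain ⟨B, hB⟩ := Finset.bddAbove (CS.image fun c =>
    |(cornerDart c).1.1| + |(cornerDart c).1.2| + |(cornerDart c).2.1| + |(cornerDart c).2.2|)
  refine ⟨max B 0, le_max_right _ _, fun c hc => ?_⟩
  have h := hB (Finset.mem_coe.2 (Finset.mem_image_of_mem _ hc))
  have h0 := abs_nonneg (cornerDart c).1.1
  have h1 := abs_nonneg (cornerDart c).1.2
  have h2 := abs_nonneg (cornerDart c).2.1
  have h3 := abs_nonneg (cornerDart c).2.2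
  have hB' : B ≤ max B 0 := le_max_left _ _
  exact ⟨by linarith, by linarith, by linarith, by linarith⟩

/-- West of the box the weighted dart sum vanishes. [folklore] -/
theorem hw_eq_zero_of_lt {B : ℤ}
    (hB : ∀ c ∈ CS, |(cornerDart c).1.1| ≤ B ∧ |(cornerDart c).1.2| ≤ B ∧ |(cornerDart c).2.1| ≤ B ∧ |(cornerDart c).2.2| ≤ B)
    (F : MedialTrail.Pt) (hF : F.1 < -B) : (∑ c ∈ CS, w c * dartWnd (cornerDart c) F) = 0 := by
  refine Finset.sum_eq_zero fun c hc => ?_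
  have h := (hB c hc).1
  rw [abs_le] at h
  rw [dartWnd_eq_zero_of_lt _ _ (by omega), mul_zero]

/-- North of the box the weighted dart sum vanishes. [folklore] -/
theorem hw_eq_zero_of_above {B : ℤ}
    (hB : ∀ c ∈ CS, |(cornerDart c).1.1| ≤ B ∧ |(cornerDart c).1.2| ≤ B ∧ |(cornerDart c).2.1| ≤ B ∧ |(cornerDart c).2.2| ≤ B)
    (F : MedialTrail.Pt) (hF : B < F.2) : (∑ c ∈ CS, w c * dartWnd (cornerDart c) F) = 0 := by
  refine Finset.sum_eq_zero fun c hc => ?_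
  obtain ⟨-, h2, -, h4⟩ := hB c hc
  rw [abs_le] at h2 h4
  rw [dartWnd_eq_zero_of_le _ _ (by omega) (by omega), mul_zero]

/-- South of the box the weighted dart sum vanishes. [folklore] -/
theorem hw_eq_zero_of_below {B : ℤ}
    (hB : ∀ c ∈ CS, |(cornerDart c).1.1| ≤ B ∧ |(cornerDart c).1.2| ≤ B ∧ |(cornerDart c).2.1| ≤ B ∧ |(cornerDart c).2.2| ≤ B)
    (F : MedialTrail.Pt) (hF : F.2 < -B) : (∑ c ∈ CS, w c * dartWnd (cornerDart c) F) = 0 := by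
  refine Finset.sum_eq_zero fun c hc => ?_
  obtain ⟨-, h2, -, h4⟩ := hB c hc
  rw [abs_le] at h2 h4
  rw [dartWnd_eq_zero_of_gt _ _ (by omega) (by omega), mul_zero]

/-- East of the box the weighted dart sum vanishes (under the cycle condition: no horizontal jumps
there, and the sum vanishes far south). [folklore] -/
theorem hw_eq_zero_of_gt
    (hdiv : ∀ g : ℤ × ℤ → ℤ, ∑ c ∈ CS, w c * (g (cornerDart c).2 - g (cornerDart c).1) = 0) {B : ℤ}
    (hB : ∀ c ∈ CS, |(cornerDart c).1.1| ≤ B ∧ |(cornerDart c).1.2| ≤ B ∧ |(cornerDart c).2.1| ≤ B ∧ |(cornerDart c).2.2| ≤ B)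
    (F : MedialTrail.Pt) (hF : B < F.1) : (∑ c ∈ CS, w c * dartWnd (cornerDart c) F) = 0 := by
  obtain ⟨x, y⟩ := F
  simp only at hF
  have step : ∀ y', (∑ c ∈ CS, w c * dartWnd (cornerDart c) (x, y')) =
      ∑ c ∈ CS, w c * dartWnd (cornerDart c) (x, y' - 1) := by
    intro y'
    have h := hw_sub_south CS w hdiv x y'
    have h0 : ∑ c ∈ CS, w c * ((if cornerDart c = ((x, y'), (x + 1, y')) then 1 else 0) -
        (if cornerDart c = ((x + 1, y'), (x, y')) then 1 else 0)) = 0 := by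
      refine Finset.sum_eq_zero fun c hc => ?_
      obtain ⟨h1, -, h3, -⟩ := hB c hc
      rw [abs_le] at h1 h3
      rw [if_neg, if_neg, sub_zero, mul_zero]
      · intro h'; rw [h'] at h3; simp only at h3; omega
      · intro h'; rw [h'] at h1; simp only at h1; omega
    rw [h0, sub_eq_zero] at h
    exact h
  have desc : ∀ n : ℕ, (∑ c ∈ CS, w c * dartWnd (cornerDart c) (x, y)) =
      ∑ c ∈ CS, w c * dartWnd (cornerDart c) (x, y - n) := by
    intro n
    induction n with
    | zero => simp
    | succ n ih => rw [ih, step]; congr 1; ext c; push_cast; ring_nf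
  rw [desc (y + B + 1).toNat]
  exact hw_eq_zero_of_below CS w hB _ (by simp only; omega)

/-- **The weighted dart sum vanishes outside the box** of its darts. [folklore] -/
theorem hw_eq_zero_of_far
    (hdiv : ∀ g : ℤ × ℤ → ℤ, ∑ c ∈ CS, w c * (g (cornerDart c).2 - g (cornerDart c).1) = 0) {B : ℤ}
    (hB : ∀ c ∈ CS, |(cornerDart c).1.1| ≤ B ∧ |(cornerDart c).1.2| ≤ B ∧ |(cornerDart c).2.1| ≤ B ∧ |(cornerDart c).2.2| ≤ B)
    (F : MedialTrail.Pt) (hF : B < |F.1| ∨ B < |F.2|) : (∑ c ∈ CS, w c * dartWnd (cornerDart c) F) = 0 := by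
  rcases hF with hF | hF
  · rcases lt_abs.1 hF with h | h
    · exact hw_eq_zero_of_gt CS w hdiv hB F h
    · exact hw_eq_zero_of_lt CS w hB F (by omega)
  · rcases lt_abs.1 hF with h | h
    · exact hw_eq_zero_of_above CS w hB F h
    · exact hw_eq_zero_of_below CS w hB F (by omega)

end Weighted

/-! ### Registered sub-goal of this Part -/

/-- **Sub-goal `s17_heightsExist_part1`** (registered on stmt-CriticalPhenomena-14132; T5c of the
insertion dictionary D2, Part 1): for a finite set of corners `CS` and integer weights `w`
satisfying the cycle condition `∑_{c ∈ CS} w(c) (g(head c) - g(tail c)) = 0` for every `g`, the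
weighted dart winding number `H(F) = ∑_{c ∈ CS} w(c) · dartWnd(cornerDart c, F)` drops by exactly
`w(c₁)` (by `0` off `CS`) from the vertex square `vcell c₁.1` to the face square `fcell (cFace c₁)`
of every corner `c₁`. [folklore] -/
theorem s17_heightsExist_part1 : ∀ (CS : Finset (Literature.Probability.LatticeModels.Site 2 × Fin 4)) (w : Literature.Probability.LatticeModels.Site 2 × Fin 4 → ℤ), (∀ g : ℤ × ℤ → ℤ, ∑ c ∈ CS, w c * (g (Literature.Probability.Percolation.cornerDart c).2 - g (Literature.Probability.Percolation.cornerDart c).1) = 0) → ∀ c₁ : Literature.Probability.LatticeModels.Site 2 × Fin 4, (∑ c ∈ CS, w c * Literature.Probability.LatticeModels.MedialTrail.dartWnd (Literature.Probability.Percolation.cornerDart c) (Literature.Probability.Percolation.vcell c₁.1)) - (∑ c ∈ CS, w c * Literature.Probability.LatticeModels.MedialTrail.dartWnd (Literature.Probability.Percolation.cornerDart c) (Literature.Probability.Percolation.fcell (Literature.Probability.LatticeModels.cFace c₁))) = if c₁ ∈ CS then w c₁ else 0 :=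
  fun CS w hdiv c₁ => hw_jump_corner CS w hdiv c₁

end Summit.CriticalPhenomena.CardyFormulaZ2.Cruxes.BoundaryDefectGaussianR.RainbowMonomialsInExcursionKernels
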